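import Literature.NumberTheory.EllipticCurves.BSDSelmerPConverse
import Literature.NumberTheory.EllipticCurves.NonvanishingTwists
import Literature.NumberTheory.EllipticCurves.HeegnerHypothesisKroneckerProofs
import HarnessLib

/-!
# Non-vanishing of a quadratic twist at the centre with prescribed splitting at the bad primes
# AND at the primes dividing an arbitrary auxiliary integer (Friedberg–Hoffstein 1995) — named fact

Topic `Literature/NumberTheory/EllipticCurves`. ONE named fact (D-0014, statement only, no
`_holds`), the finite-set form of the tree's
`Literature.NumberTheory.EllipticCurves.friedbergHoffstein_exists_heegnerField_split_twist_ne_zero`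
(`BSDSelmerPConverse.lean`, CITED-FACTS registry of the cell `b2b-bsdres`): there the auxiliary
splitting condition is imposed at ONE prime `p`; here at every prime dividing an arbitrary nonzero
integer `M` — i.e. at an arbitrary FINITE set of primes. Both are the same special case of the
same printed theorem, used in print in exactly this generality:

* Jetchev–Skinner–Wan, Camb. J. Math. 5 (2017) = arXiv:1512.06894, §7.4.1 (p. 30 of the held
  text, read verbatim): having imposed on the auxiliary imaginary quadratic field `𝒦' = ℚ(√D')`
  the conditions "(a) `N` and `𝒦'` satisfy (gen-H); (b) `q` is either inert or ramified in `𝒦'`;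
  (c) `p` splits in `𝒦'`", they write: "for any `𝒦'` for which (a), (b), and (c) hold, the root
  number `w(E/𝒦')` of `E/𝒦'` is `−1` […] As `w(E/ℚ) = −1` by hypothesis […] and
  `w(E/𝒦') = w(E/ℚ)w(E^{D'}/ℚ)`, we have `w(E^{D'}) = +1`. As (a), (b), and (c) impose only finitely
  many congruence conditions on the discriminant of `𝒦'`, it then follows from a result of
  Friedberg and Hoffstein [FH] that `𝒦'` can be chosen so that (d) [`L(E^{D'},1) ≠ 0`] also
  holds."; likewise §7.4.2 (p. 31): "(a) the primes dividing `N⁺` split in `𝒦''`; (b) the primes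
  dividing `N⁻` are all inert in `𝒦''`; (c) `p` splits in `𝒦''`; (d) `L(E^{D''}, 1) ≠ 0`. […] the
  root number of the quadratic twist `E^{D''}` is `+1` and the result of Friedberg and Hoffstein
  ensures that `𝒦''` can be chosen so that (d) also holds."
* Burungale–Skinner–Tian–Wan, arXiv:2409.01350, Part II, proof of Thm. 4.3 (p. 82 of the held
  text): "The existence of `L` is a special case of the main result of [FH]" (cited verbatim in the
  sibling's docstring).
* The theorem itself: S. Friedberg, J. Hoffstein, *Nonvanishing theorems for automorphic
  `L`-functions on `GL(2)`*, Ann. of Math. 142 (1995) 385–423, Theorem B (text NOT held by the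
  cell — acquisition requested by earlier seats; paraphrase as used in the two sources above and in
  the sibling fact): for a cuspidal automorphic representation `π` of `GL₂` over a number field and
  quadratic characters `χ` with prescribed local components at a finite set of places, in a class
  for which `ε(π ⊗ χ, 1/2) = +1`, infinitely many such `χ` have `L(π ⊗ χ, 1/2) ≠ 0`.

Here: `E/ℚ` elliptic (`π = π_E` by modularity) with sign `w(E) = −1` (`WeierstrassCurve.rootNumber`),
conductor `N = W.conductorNorm ℤ`, `M ≠ 0` an integer; the prescribed local behaviour is
"`K = ℚ(√D)` imaginary (`χ_∞ = sgn`), `χ_{D,ℓ}` trivial — i.e. `ℓ` split in `K` — at every prime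
`ℓ ∣ N` and at every prime `ℓ ∣ M`" (finitely many places), a class in which
`w(E^{(D)}) = w(E)·w(E/K)⁻¹… = χ_D(−N) w(E) = (−1)·(−1) = +1` exactly as in JSW's sentence (every
`ℓ ∣ N` splits, `D < 0`; the conditions at the primes of `M` do not enter the sign); conclusion:
infinitely many such `K` (for every bound `B` one with `|d_K| > B`) have `L(E^{(d_K)}, 1) ≠ 0`,
written with the tree's `W.quadraticTwist d_K` and its entire `L`-function, and "every prime
dividing `M` splits in `K`" written `SatisfiesHeegnerHypothesis M K` (the tree's predicate: every
prime factor has two primes above it in `𝓞 K`), all verbatim as in the sibling.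

WEAKER THAN PRINT: only `F = ℚ`, only holomorphic weight `2` (elliptic curves), only the "split"
local prescription (no inert/ramified conditions, no real quadratic twists), only `L ≠ 0` (no
simultaneous non-vanishing). The sibling (`M = p`) and Waldspurger's case (`M = 1`, the tree's
`waldspurger_exists_heegnerField_twist_ne_zero`) FOLLOW from this fact — proved below
(`…_of_splitDivisors`), so a consumer holding this binder needs neither of the other two.

First consumer: `Summits/BirchSwinnertonDyer/Rank1Residual/X12/CMGoodOddPrimeAnyConductor.lean`
(cell `b2b-bsdres`, unit `b2b-bsdres-x1b` gen 21): the upper half of `BSD(E,p)` for a CM curve of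
analytic rank one at ANY odd prime unramified in the CM field, ANY conductor — the auxiliary
integer is `M = 2p` (both `2` and `p` split in the Heegner field: `d_K` odd and prime to `p`).

## References
* [FriedbergHoffstein1995] S. Friedberg, J. Hoffstein, Ann. of Math. 142 (1995) 385–423, Thm. B.
* [JetchevSkinnerWan2017] D. Jetchev, C. Skinner, X. Wan, Camb. J. Math. 5 (2017) 369–434
  = arXiv:1512.06894, §7.4.1 (p. 30), §7.4.2 (p. 31).
* [BurungaleSkinnerTianWan2024] A. Burungale, C. Skinner, Y. Tian, X. Wan, arXiv:2409.01350,
  Part II, proof of Thm. 4.3 (p. 82).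
-/

noncomputable section

open scoped Classical

open WeierstrassCurve

namespace Literature.NumberTheory.EllipticCurves

/-- **Non-vanishing quadratic twist with prescribed splitting at the bad primes and at the primes
of an arbitrary auxiliary integer** (Friedberg–Hoffstein 1995, Thm. B, in the special case used by
Jetchev–Skinner–Wan 2017 §7.4.1–7.4.2 — "(a), (b), and (c) impose only finitely many congruence
conditions on the discriminant of `𝒦'`, it then follows from a result of Friedberg and Hoffstein
that `𝒦'` can be chosen so that (d) [`L(E^{D'},1) ≠ 0`] also holds" — and by
Burungale–Skinner–Tian–Wan 2024, Part II, proof of Thm. 4.3). For `W/ℚ` elliptic with root number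
`−1`, every integer `M ≠ 0` and every bound `B`: there is an imaginary quadratic field `K` with
`|d_K| > B` in which every prime dividing `N_W` splits (`SatisfiesHeegnerHypothesis (N W) K`) AND
every prime dividing `M` splits (`SatisfiesHeegnerHypothesis M K`), and with `L(W^{(d_K)}, 1) ≠ 0`.
The sibling `friedbergHoffstein_exists_heegnerField_split_twist_ne_zero` is the case `M = p` prime;
Waldspurger's `waldspurger_exists_heegnerField_twist_ne_zero` is the case `M = 1`. Weaker than
print (only `ℚ`, weight `2`, split-type prescriptions, one `L`-value). Named fact (statement only).
[cite: FriedbergHoffstein1995, Thm. B (special case: quadratic characters trivial at a finite set of places, sign +1); JetchevSkinnerWan2017, §7.4.1 (p. 30) and §7.4.2 (p. 31); BurungaleSkinnerTianWan2024, Part II, proof of Thm. 4.3 (p. 82)] -/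
def friedbergHoffstein_exists_heegnerField_splitDivisors_twist_ne_zero : Prop :=
  ∀ (W : WeierstrassCurve ℚ) [W.IsElliptic], W.rootNumber = -1 → ∀ (M : ℕ), M ≠ 0 →
    ∀ B : ℕ, ∃ (K : Type) (_ : Field K) (_ : NumberField K),
      IsImaginaryQuadratic K ∧ B < (NumberField.discr K).natAbs ∧
        SatisfiesHeegnerHypothesis (W.conductorNorm ℤ) K ∧ SatisfiesHeegnerHypothesis M K ∧
          (W.quadraticTwist (NumberField.discr K : ℚ)).entireLFunction 1 ≠ 0

/-- The one-prime form `friedbergHoffstein_exists_heegnerField_split_twist_ne_zero` (the cell's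
registered sibling) FOLLOWS from the finite-set form (take `M = p`).
[cite: FriedbergHoffstein1995, Thm. B] [cite: JetchevSkinnerWan2017, §7.4.2 (p. 31)] -/
theorem friedbergHoffstein_exists_heegnerField_split_twist_ne_zero_of_splitDivisors
    (h : friedbergHoffstein_exists_heegnerField_splitDivisors_twist_ne_zero) :
    friedbergHoffstein_exists_heegnerField_split_twist_ne_zero :=
  fun W _ hw p hp B ↦ h W hw p hp.ne_zero B

/-- Waldspurger's form `waldspurger_exists_heegnerField_twist_ne_zero` (no auxiliary condition)
FOLLOWS from the finite-set form (take `M = 1`).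
[cite: FriedbergHoffstein1995, Thm. B] [cite: Darmon2004, §3.9, proof of Thm. 3.22] -/
theorem waldspurger_exists_heegnerField_twist_ne_zero_of_splitDivisors
    (h : friedbergHoffstein_exists_heegnerField_splitDivisors_twist_ne_zero) :
    waldspurger_exists_heegnerField_twist_ne_zero := by
  intro W _ hw B
  obtain ⟨K, hF, hN, hK, hB, hHN, -, hL⟩ := h W hw 1 one_ne_zero B
  exact ⟨K, hF, hN, hK, hB, hHN, hL⟩

/-- Unpacking for consumers: a Heegner field for `N_W` in which, in addition, two given primes
`p` and `q` split, with `|d_K| > B` and `L(W^{(d_K)},1) ≠ 0` (`M = p·q`).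
[cite: FriedbergHoffstein1995, Thm. B] [cite: JetchevSkinnerWan2017, §7.4.1 (p. 30)] -/
theorem exists_heegnerField_split_two_primes_twist_ne_zero
    (h : friedbergHoffstein_exists_heegnerField_splitDivisors_twist_ne_zero)
    (W : WeierstrassCurve ℚ) [W.IsElliptic] (hw : W.rootNumber = -1) {p q : ℕ} (hp : p.Prime)
    (hq : q.Prime) (B : ℕ) :
    ∃ (K : Type) (_ : Field K) (_ : NumberField K),
      IsImaginaryQuadratic K ∧ B < (NumberField.discr K).natAbs ∧
        SatisfiesHeegnerHypothesis (W.conductorNorm ℤ) K ∧ SatisfiesHeegnerHypothesis p K ∧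
          SatisfiesHeegnerHypothesis q K ∧
            (W.quadraticTwist (NumberField.discr K : ℚ)).entireLFunction 1 ≠ 0 := by
  obtain ⟨K, hF, hN, hK, hB, hHN, hHM, hL⟩ := h W hw (p * q) (mul_ne_zero hp.ne_zero hq.ne_zero) B
  exact ⟨K, hF, hN, hK, hB, hHN, hHM.of_dvd (dvd_mul_right p q), hHM.of_dvd (dvd_mul_left q p), hL⟩

/-! ### Prescribed behaviour at `2`: a Heegner field with `p` split and ODD discriminant -/

/-- **Heegner field with `p` split, `d_K` ODD and `L(W^{(d_K)},1) ≠ 0`** — the local condition at `2`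
("`d_K` odd", i.e. `2` unramified in `K`, demanded by the Bertolini–Darmon–Prasanna /
Jetchev–Skinner–Wan frame; cf. Skinner, Ann. of Math. 191 (2020), proof of Thm. A from Thm. B,
p. 4 of arXiv:1405.7294: "an imaginary quadratic field `K` can be chosen so that its discriminant
`D` is odd; (b), (c), and (d) hold; and `L(A_f^D,1) ≠ 0` […] the existence of a `K` with the desired
properties follows from [Friedberg–Hoffstein]") is ONE MORE splitting condition: take the auxiliary
integer `M = 2p` in `friedbergHoffstein_exists_heegnerField_splitDivisors_twist_ne_zero`
(`exists_heegnerField_split_two_primes_twist_ne_zero` with the primes `2` and `p`); a prime that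
splits in the quadratic field `K` does not divide `d_K` (`SatisfiesHeegnerHypothesis.not_dvd_discr`,
at `2`: `d_K ≡ 1 (mod 8)`), so `d_K` is odd. For `W/ℚ` elliptic with root number `−1`, a prime `p`
and a bound `B`: an imaginary quadratic `K` with `|d_K| > B`, every prime of `N_W` split, `p` split,
`2` split, `d_K` odd, and `L(W^{(d_K)},1) ≠ 0`. PROVED from the finite-set named fact (no new fact).
[cite: FriedbergHoffstein1995, Thm. B] [cite: JetchevSkinnerWan2017, §7.4.1 (p. 30)] -/
theorem exists_heegnerField_split_two_split_oddDiscr_twist_ne_zero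
    (h : friedbergHoffstein_exists_heegnerField_splitDivisors_twist_ne_zero)
    (W : WeierstrassCurve ℚ) [W.IsElliptic] (hw : W.rootNumber = -1) {p : ℕ} (hp : p.Prime)
    (B : ℕ) :
    ∃ (K : Type) (_ : Field K) (_ : NumberField K),
      IsImaginaryQuadratic K ∧ B < (NumberField.discr K).natAbs ∧
        SatisfiesHeegnerHypothesis (W.conductorNorm ℤ) K ∧ SatisfiesHeegnerHypothesis p K ∧
          SatisfiesHeegnerHypothesis 2 K ∧ Odd (NumberField.discr K) ∧
            (W.quadraticTwist (NumberField.discr K : ℚ)).entireLFunction 1 ≠ 0 := by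
  obtain ⟨K, hF, hN, hK, hB, hHN, hH2, hHp, hL⟩ :=
    exists_heegnerField_split_two_primes_twist_ne_zero h W hw Nat.prime_two hp B
  refine ⟨K, hF, hN, hK, hB, hHN, hHp, hH2, ?_, hL⟩
  have h2 : ¬ (2 : ℤ) ∣ NumberField.discr K := by
    simpa using Literature.SatisfiesHeegnerHypothesis.not_dvd_discr hK.1 hH2 Nat.prime_two
      (dvd_refl 2)
  exact Int.not_even_iff_odd.mp fun he ↦ h2 (even_iff_two_dvd.mp he)

/-- **The one-prime Friedberg–Hoffstein form WITH odd discriminant** — verbatim the registered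
sibling `friedbergHoffstein_exists_heegnerField_split_twist_ne_zero` (`BSDSelmerPConverse.lean`)
plus the conjunct `Odd (NumberField.discr K)` (the shape asked for by the BSD rank-`≤ 1` residual
route `SchneiderFreeAdditiveX3`, support `HeegnerTwistChoice`): for `W/ℚ` elliptic with root number
`−1`, every prime `p` and every bound `B` there is an imaginary quadratic `K` with `|d_K| > B`, every
prime of `N_W` split, `p` split, `d_K` odd and `L(W^{(d_K)},1) ≠ 0`. A THEOREM given the finite-set
fact (auxiliary integer `2p`), not a new named fact.
[cite: FriedbergHoffstein1995, Thm. B] [cite: JetchevSkinnerWan2017, §7.4.1 (p. 30) and §7.4.2 (p. 31)] -/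
theorem exists_heegnerField_split_oddDiscr_twist_ne_zero_of_splitDivisors
    (h : friedbergHoffstein_exists_heegnerField_splitDivisors_twist_ne_zero) :
    ∀ (W : WeierstrassCurve ℚ) [W.IsElliptic], W.rootNumber = -1 → ∀ (p : ℕ), p.Prime →
      ∀ B : ℕ, ∃ (K : Type) (_ : Field K) (_ : NumberField K),
        IsImaginaryQuadratic K ∧ B < (NumberField.discr K).natAbs ∧
          SatisfiesHeegnerHypothesis (W.conductorNorm ℤ) K ∧ SatisfiesHeegnerHypothesis p K ∧
            Odd (NumberField.discr K) ∧
              (W.quadraticTwist (NumberField.discr K : ℚ)).entireLFunction 1 ≠ 0 := by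
  intro W _ hw p hp B
  obtain ⟨K, hF, hN, hK, hB, hHN, hHp, -, hodd, hL⟩ :=
    exists_heegnerField_split_two_split_oddDiscr_twist_ne_zero h W hw hp B
  exact ⟨K, hF, hN, hK, hB, hHN, hHp, hodd, hL⟩

end Literature.NumberTheory.EllipticCurves

end
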